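import Summits.BirchSwinnertonDyer.BirchSwinnertonDyer.Theorems.EisensteinPrimesAcTwistDeformationSurAtVbarOfForallDatumOfTateTC
import Summits.BirchSwinnertonDyer.BirchSwinnertonDyer.Theorems.EisensteinPrimesAcTwistDeformationSurAtVbarOfDatumOfSurC
import HarnessLib

/-!
# v30 «SurC» re-typing of `EisensteinPrimesAcTwistDeformationSurAtVbarOfForallDatumOfTateTC`: Greenberg 2016 Prop. 2.6.3 by name ↦ its case (c) at totally complex `K` by name

Route `EisensteinPrimes` (rung K5), crux 2 `GoodLatticeBDPValue` (stmt-BirchSwinnertonDyer-19032), line `halves`;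
cell `bsd-eis`, width seat `bsd-line-x1-p1-w5` gen 9 for LEAD g9 (LEAD ROUTING #3, 2026-08-29), helper (`--supports`).

This file re-types, token for token, the theorems of `EisensteinPrimesAcTwistDeformationSurAtVbarOfForallDatumOfTateTC` that carry Greenberg 2016
Prop. 2.6.3 = Greenberg 2010 Prop. 3.2.1 BY NAME (`h263 : Greenberg2016.prop263_sur_of_crk`: SUR(𝐃, 𝓛) from
LEO + CRK + (a) ∨ (b) ∨ (c), every number field) with that hypothesis replaced by its CASE (c) AT TOTALLY
COMPLEX FIELDS (`h263 : Greenberg2016.prop263_sur_of_crk_caseC_tc`, the special case p696608 appended to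
`Literature/…/Greenberg2016/GlobalToLocalSurjectivity.lean`): every leaf of the line applies Prop. 2.6.3 in case (c)
(`η = 𝔭`, `Q_𝓛(K_𝔭, 𝐃) = 0` divisible) at an imaginary quadratic — hence totally complex — `K`, so the weaker
hypothesis suffices; the special case is the END STATEMENT of the cell's kernel road «SUR-Λ»
(`prop263_sur_of_crk_caseC_tc_holds`, from the tree's Poitou–Tate at totally complex fields), after which the
LEAD drops the name from the line (v30).  Statements are otherwise VERBATIM (same binder order, new names
`<name>_ofSurC`); proofs are the tree proofs with the last argument of the leaf call, the third-disjunct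
injection of the case-(c) witness, replaced by the witness itself (the `IsTotallyComplex K` instance being
supplied from `IsImaginaryQuadratic K`) and the re-typed
callees called; helpers without `h263` are used from the imported `…OfTateTC` file unchanged.

Theorems only; no definition, no named fact, no `sorry`, no instance. HONEST FRAMING: conditional on the PUBLISHED
named facts carried as hypotheses; closes nothing by itself; no summit statement / BSD / the crux is proved here.

## References
* R. Greenberg, *On the structure of Selmer groups*, Springer PROMS 188 (2016), Prop. 2.6.3 (§2.6 p. 10). [Greenberg2016Selmer]
* R. Greenberg, *Surjectivity of the global-to-local map defining a Selmer group*, Kyoto J. Math. 50 (2010), Prop. 3.2.1 (c) (p. 15). [Greenberg2010]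
* (the references of the re-typed file apply verbatim)
-/

set_option autoImplicit false
-- `Summit.<P>.<Sub>` repeats `BirchSwinnertonDyer` by the tree's layout convention (D-0017)
set_option linter.dupNamespace false

noncomputable section

open scoped Classical
open NumberField IsDedekindDomain Field Multiplicative PowerSeries WeierstrassCurve
open Literature.NumberTheory.EllipticCurves Literature.NumberTheory.EllipticCurves.GreenbergSelmer
  Literature.NumberTheory.EllipticCurves.GreenbergVatsal2000 Literature.NumberTheory.GaloisRepresentations
  Literature.NumberTheory.EllipticCurves.KellerYin2024 Literature.NumberTheory.EllipticCurves.IwasawaDual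
  Literature.NumberTheory.EllipticCurves.Castella2018.AcSelmer
  Literature.NumberTheory.IwasawaTheory Literature.NumberTheory.IwasawaTheory.Greenberg2016
  Literature.NumberTheory.IwasawaTheory.Greenberg2006
  Summit.BirchSwinnertonDyer.BirchSwinnertonDyer.Theorems.GreenbergFullAtSelmer
  Summit.BirchSwinnertonDyer.BirchSwinnertonDyer.Theorems.AcTwistDeformationResidualPair

namespace Summit.BirchSwinnertonDyer.BirchSwinnertonDyer.Theorems.AcTwistDeformation

section SurAtVbarOfForallDatum

variable {K : Type} [Field K] [NumberField K] {p : ℕ} [Fact p.Prime]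

/-- **[v30 `OfSurC` re-typing: Greenberg 2016 Prop. 2.6.3 by name ↦ its case (c) at totally complex `K` by name (`prop263_sur_of_crk_caseC_tc`).]** [cite: Greenberg2010, Prop. 3.2.1 (c) (p. 15)] **[T28b `OfTateTC` re-typing: Greenberg 2006 Prop. 3.2 by name ↦ Milne ADT I Thm. 5.1 by name AT TOTALLY COMPLEX FIELDS (Prop. 3.2 is read in degrees ≤ 2 and at totally complex fields only, `prop32_global_le_two_of_tate_tc`).]** [cite: MilneADT2006, I Thm. 5.1 (p. 67)] **SUR_θ at `v̄` in the `hsur` currency, from v20.1's own antecedent `∀ D : DatumDualData … ↑Sf,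
Module.Finite ∧ IsTorsion ∧ μ = 0`** (`hSsub` for `θ = θsub`, `hSquot` for `θ = θquot`): for any `c` with
`κ(D_v̄) = p^c ℤ_p` exactly, every `y : Fin (p^c) → H¹(ker κ ⊓ D_v̄, (F/𝒪)(θ))` is `(res_{ker κ ⊓ D_v̄}(conj_{γ^i} u))_i`
for some `u ∈ unramifiedOutside κ.kerSubgroup (F/𝒪)(θ) p ↑Sf`. A datum exists
(`KellerYin2024.nonempty_unrDualData_char`); apply `char_forall_fin_…_of_datum` to it.
[cite: Greenberg2016Selmer, Prop. 2.6.3 (c), §4.3 pp. 20–21] [cite: KellerYin2024, Thm. 1.2.2 and Rem. 1.4.2 (arXiv:2402.12781v2 TeX L1130–1140)] -/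
theorem char_forall_fin_exists_unramifiedOutside_resOfLe_conjH1_pow_eq_of_forall_datum_ofSurC
    (h263 : prop263_sur_of_crk_caseC_tc)
    (h41 : prop41_globalEulerPoincareCorank) (h42 : prop42_localEulerPoincareCorank)
    (h5A : sec5A_localH2_subsingleton_of_LOC1) (h32 : (∀ (L : Type) [Field L] [NumberField L] [IsTotallyComplex L], Literature.NumberTheory.GaloisCohomology.tateGlobalEulerPoincareCharacteristic L))
    (W : WeierstrassCurve ℚ) [W.IsElliptic] (hp : 2 < p) (hK : IsImaginaryQuadratic K)
    (hH : SatisfiesHeegnerHypothesis (W.conductorNorm ℤ) K)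
    {ι : K →+* ℚ_[p]} {v vbar : HeightOneSpectrum (𝓞 K)}
    (hvι : ∀ x : 𝓞 K, x ∈ v.asIdeal ↔ ‖ι (x : K)‖ < 1)
    (hvbar : ((p : ℕ) : 𝓞 K) ∈ vbar.asIdeal) (hne : vbar ≠ v)
    (κ : ZpExtension K p) (hκ : κ.IsAnticyclotomic) (γ : absoluteGaloisGroup K)
    [hγ : Fact (κ.IsTopGenerator γ)]
    {θsub θquot : FramedGaloisRep K (padicCoeffIntegers (∅ : Set (PadicAlgCl p))) 1}
    (hpair : IsResidualPairOver (W.baseChange K) p θsub θquot)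
    (Sf : Finset (HeightOneSpectrum (𝓞 K)))
    (hSf : ∀ w : HeightOneSpectrum (𝓞 K), w ∈ Sf ↔ ((W.conductorNorm ℤ : ℤ) : 𝓞 K) ∈ w.asIdeal)
    (θ : FramedGaloisRep K (padicCoeffIntegers (∅ : Set (PadicAlgCl p))) 1) (hθ : θ = θsub ∨ θ = θquot)
    (hSθ : ∀ D : DatumDualData κ γ (charModule (∅ : Set (PadicAlgCl p)) θ)
      (Castella2018.AcSelmer.bdpData (charModule (∅ : Set (PadicAlgCl p)) θ) p vbar)
      (↑Sf : Set (HeightOneSpectrum (𝓞 K))),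
      Module.Finite (IwasawaAlgebra p) D.X ∧ Module.IsTorsion (IwasawaAlgebra p) D.X ∧ muInvariant p D.X = 0)
    (c : ℕ) (hc : ∃ δ ∈ decomp (K := K) vbar, (κ δ).toAdd = (p : ℤ_[p]) ^ c)
    (hcd : ∀ δ ∈ decomp (K := K) vbar, (p : ℤ_[p]) ^ c ∣ (κ δ).toAdd) :
    ∀ y : Fin (p ^ c) →
        subgroupH1 (κ.kerSubgroup ⊓ decomp (K := K) vbar) (charModule (∅ : Set (PadicAlgCl p)) θ),
      ∃ u ∈ unramifiedOutside κ.kerSubgroup (charModule (∅ : Set (PadicAlgCl p)) θ) p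
          (↑Sf : Set (HeightOneSpectrum (𝓞 K))),
        ∀ i : Fin (p ^ c),
          resOfLe (charModule (∅ : Set (PadicAlgCl p)) θ)
            (inf_le_left : κ.kerSubgroup ⊓ decomp (K := K) vbar ≤ κ.kerSubgroup)
            (conjH1 κ.kerSubgroup (charModule (∅ : Set (PadicAlgCl p)) θ) (γ ^ (i : ℕ)) u) = y i := by
  obtain ⟨D⟩ := nonempty_unrDualData_char (∅ : Set (PadicAlgCl p)) θ κ vbar
    (↑Sf : Set (HeightOneSpectrum (𝓞 K))) hγ.out
  obtain ⟨hDfin, hDtor, -⟩ := hSθ D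
  exact char_forall_fin_exists_unramifiedOutside_resOfLe_conjH1_pow_eq_of_datum_ofSurC h263 h41 h42 h5A h32 W hp hK hH
    hvι hvbar hne κ hκ γ hpair Sf hSf θ hθ D hDfin hDtor c hc hcd

end SurAtVbarOfForallDatum

end Summit.BirchSwinnertonDyer.BirchSwinnertonDyer.Theorems.AcTwistDeformation

end
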